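import Summits.AtomisticToContinuum.Crystallization.Theorems.ThreeConeCertificateExactCertificateInvisibility
import Summits.AtomisticToContinuum.Crystallization.Theorems.ThreeConeCertificateExactCertificateInvisibilitySliceDim
import Summits.AtomisticToContinuum.Crystallization.Theorems.ThreeConeCertificateExactCertificateInvisibilityRadialDim
import HarnessLib

/-!
# Crux `ExactCertificate` (stmt-AtomisticToContinuum-11959), line `closure-makes-nogap-exact`, skeleton VIII:
# the invisibility dichotomy in EVERY dimension `d ≥ 2` (registered assembly stub `stub_dimAssembly`)

Support file for the crux `ThreeConeCertificate.ExactCertificate`.  `…Invisibility.lean` proved that no nonzero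
finite-range continuous radial kernel on `ℝ³` has Fourier transform vanishing on a lattice plane minus the origin.
The proof is dimension-free above `d = 1`: the slice along an axis is entire of exponential type in any `ℝᵈ`
(`stub_sliceEntireDim`), the Fourier transform of a radial function is radial in any `ℝᵈ` (`stub_fourierRadialDim`), and
the norms `‖n k₁ + j k₂‖` depend on `k₁, k₂ ∈ ℝᵈ` only through their Gram data, which is realised by two vectors of
`ℝ³` (`exists_gramModel`), where the engine `entire_eq_zero_of_vanish_on_latticeNorms` applies.  Result
(`stub_dimAssembly` = `radial_eq_zero_of_fourier_vanish_dim`): for every `d`, every pair of independent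
`k₁, k₂ ∈ ℝᵈ` and every continuous `α : ℝ → ℝ` vanishing on `[L, ∞)`, if `𝓕(α∘‖·‖)(n k₁ + j k₂) = 0` for all
`(n, j) ≠ (0, 0)` then `α ≡ 0` on `[0, ∞)`.  Independent pairs exist exactly when `d ≥ 2`; in `d = 1` the statement
fails (`stub_oneDimKernel`).  So: **finite-range continuous radial kernels whose Fourier transform vanishes on a
lattice of rank ≥ 2 minus the origin exist in NO dimension; invisible finite-range kernels exist iff `d = 1`** — the
d = 1 / d ≥ 2 break of the Transfer lane (STRATEGY-CENSUS §2a(α), §2b) as a theorem.  All `[folklore]`.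
-/

noncomputable section

namespace Summit.AtomisticToContinuum.Crystallization.Theorems.ThreeConeCertificateExactCertificate.Invisibility

open MeasureTheory Set Filter Topology
open Summit.AtomisticToContinuum.Crystallization.Theorems.ChargedEnergyGapNegative (E3)
open scoped BigOperators FourierTransform RealInnerProductSpace

/-! ## Gram models in `ℝ³` -/

/-- **Gram model.** Positive binary Gram data `A > 0`, `B² < AC` are realised by two independent vectors of `ℝ³`:
`k₁ = (√A, 0, 0)`, `k₂ = (B/√A, √(C − B²/A), 0)`, with `‖n k₁ + j k₂‖² = A n² + 2B n j + C j²`. [folklore] -/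
theorem exists_gramModel (A B C : ℝ) (hA : 0 < A) (hAC : B ^ 2 < A * C) :
    ∃ k₁ k₂ : E3, LinearIndependent ℝ ![k₁, k₂] ∧
      ∀ n j : ℤ, ‖(n : ℝ) • k₁ + (j : ℝ) • k₂‖ ^ 2 = A * n ^ 2 + 2 * B * n * j + C * j ^ 2 := by
  set a : ℝ := Real.sqrt A with ha
  have ha0 : 0 < a := Real.sqrt_pos.2 hA
  have haa : a * a = A := Real.mul_self_sqrt hA.le
  set D : ℝ := C - B ^ 2 / A with hD
  have hD0 : 0 < D := by
    rw [hD, sub_pos, div_lt_iff₀ hA]; linarith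
  set e : ℝ := Real.sqrt D with he
  have he0 : 0 < e := Real.sqrt_pos.2 hD0
  have hee : e * e = D := Real.mul_self_sqrt hD0.le
  set k₁ : E3 := !₂[a, 0, 0] with hk₁
  set k₂ : E3 := !₂[B / a, e, 0] with hk₂
  refine ⟨k₁, k₂, ?_, fun n j => ?_⟩
  · rw [LinearIndependent.pair_iff]
    intro s t hst
    have h0 := congrArg (fun v : E3 => v 0) hst
    have h1 := congrArg (fun v : E3 => v 1) hst
    simp [hk₁, hk₂] at h0 h1
    have ht : t = 0 := by
      rcases h1 with h1 | h1
      · exact h1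
      · exact absurd h1 he0.ne'
    subst ht
    simp at h0
    rcases h0 with h0 | h0
    · exact ⟨h0, rfl⟩
    · exact absurd h0 ha0.ne'
  · have hc0 : ((n : ℝ) • k₁ + (j : ℝ) • k₂) 0 = n * a + j * (B / a) := by simp [hk₁, hk₂]
    have hc1 : ((n : ℝ) • k₁ + (j : ℝ) • k₂) 1 = j * e := by simp [hk₁, hk₂]
    have hc2 : ((n : ℝ) • k₁ + (j : ℝ) • k₂) 2 = 0 := by simp [hk₁, hk₂]
    rw [EuclideanSpace.norm_eq, Real.sq_sqrt (Finset.sum_nonneg fun _ _ => sq_nonneg _), Fin.sum_univ_three,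
      hc0, hc1, hc2]
    simp only [Real.norm_eq_abs, sq_abs]
    have hC : C = e * e + B ^ 2 / (a * a) := by rw [hee, hD, haa]; ring
    rw [hC, ← haa]
    field_simp
    ring

/-! ## The theorem in every dimension -/

/-- **No finite-range continuous radial kernel on `ℝᵈ` has Fourier transform vanishing on a lattice plane minus the
origin (every `d`).**  If `k₁, k₂ ∈ ℝᵈ` are independent and `α : ℝ → ℝ` is continuous, vanishes on `[L, ∞)`, and
`𝓕(α∘‖·‖)(n k₁ + j k₂) = 0` for all `(n, j) ≠ (0, 0)`, then `α ≡ 0` on `[0, ∞)`. [folklore] -/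
theorem radial_eq_zero_of_fourier_vanish_dim {d : ℕ} {k₁ k₂ : EuclideanSpace ℝ (Fin d)}
    (hli : LinearIndependent ℝ ![k₁, k₂]) (α : ℝ → ℝ) (L : ℝ) (hα : Continuous α)
    (hL : ∀ r : ℝ, L ≤ r → α r = 0)
    (hz : ∀ n j : ℤ, (n, j) ≠ (0, 0) →
      𝓕 (fun v : EuclideanSpace ℝ (Fin d) => (α ‖v‖ : ℂ)) ((n : ℝ) • k₁ + (j : ℝ) • k₂) = 0) :
    ∀ r : ℝ, 0 ≤ r → α r = 0 := by
  -- `d ≥ 1`: an axis exists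
  have hk₁0 : k₁ ≠ 0 := by
    have := hli.ne_zero 0
    simpa using this
  have hd : 0 < d := by
    rcases Nat.eq_zero_or_pos d with rfl | hd
    · exact absurd (Subsingleton.elim k₁ 0) hk₁0
    · exact hd
  set i₀ : Fin d := ⟨0, hd⟩
  -- the kernel on `ℝᵈ`
  set Ad : EuclideanSpace ℝ (Fin d) → ℂ := fun v => (α ‖v‖ : ℂ) with hAd
  have hAc : Continuous Ad := Complex.continuous_ofReal.comp (hα.comp continuous_norm)
  have hAsupp : ∀ v : EuclideanSpace ℝ (Fin d), L < ‖v‖ → Ad v = 0 := fun v hv => by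
    simp only [hAd]; rw [hL _ hv.le, Complex.ofReal_zero]
  have hAcs : HasCompactSupport Ad := by
    refine HasCompactSupport.of_support_subset_isCompact (isCompact_closedBall (0 : EuclideanSpace ℝ (Fin d)) L) ?_
    intro v hv
    rw [Metric.mem_closedBall, dist_zero_right]
    by_contra h
    exact hv (hAsupp v (not_le.1 h))
  have hAi : Integrable Ad := hAc.integrable_of_hasCompactSupport hAcs
  obtain ⟨Φ, hΦd, ⟨Bc, τ, hB⟩, hΦF⟩ := stub_sliceEntireDim d i₀ Ad L hAi hAsupp
  have hrad := stub_fourierRadialDim d (fun r : ℝ => (α r : ℂ))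
  have hnorm : ∀ {s : ℝ}, 0 ≤ s → ‖s • (EuclideanSpace.single i₀ (1 : ℝ) : EuclideanSpace ℝ (Fin d))‖ = s := by
    intro s hs
    rw [norm_smul, Real.norm_eq_abs, abs_of_nonneg hs]
    simp
  -- Gram data of `k₁, k₂` and a model pair in `ℝ³`
  set A : ℝ := ‖k₁‖ ^ 2
  set B : ℝ := ⟪k₁, k₂⟫
  set C : ℝ := ‖k₂‖ ^ 2
  have hA : 0 < A := by positivity
  have hAC : B ^ 2 < A * C := by
    -- strict Cauchy–Schwarz from independence
    have hle : B ^ 2 ≤ A * C := by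
      have := abs_real_inner_le_norm k₁ k₂
      have h' : |B| ^ 2 ≤ (‖k₁‖ * ‖k₂‖) ^ 2 := by gcongr
      rw [sq_abs] at h'
      simpa [A, C, mul_pow] using h'
    rcases hle.lt_or_eq with hlt | heq
    · exact hlt
    · exfalso
      have hk₂0 : k₂ ≠ 0 := by
        have := hli.ne_zero 1
        simpa using this
      have h1 : |⟪k₁, k₂⟫ / (‖k₁‖ * ‖k₂‖)| = 1 := by
        rw [abs_div, abs_mul, abs_norm, abs_norm, div_eq_one_iff_eq (by positivity)]
        have : |⟪k₁, k₂⟫| ^ 2 = (‖k₁‖ * ‖k₂‖) ^ 2 := by rw [sq_abs]; simpa [A, C, mul_pow] using heq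
        exact (abs_eq_abs.2 (Or.inl rfl)).trans ((sq_eq_sq₀ (abs_nonneg _) (by positivity)).1 this)
      obtain ⟨-, r, hr, hr'⟩ := (abs_real_inner_div_norm_mul_norm_eq_one_iff k₁ k₂).1 h1
      rw [LinearIndependent.pair_iff] at hli
      have := hli r (-1) (by rw [hr']; simp)
      norm_num at this
  obtain ⟨m₁, m₂, hli3, hgram⟩ := exists_gramModel A B C hA hAC
  have hnormeq : ∀ n j : ℤ, ‖(n : ℝ) • k₁ + (j : ℝ) • k₂‖ = ‖(n : ℝ) • m₁ + (j : ℝ) • m₂‖ := by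
    intro n j
    have hsq : ‖(n : ℝ) • k₁ + (j : ℝ) • k₂‖ ^ 2 = A * n ^ 2 + 2 * B * n * j + C * j ^ 2 := by
      rw [norm_add_sq_real, norm_smul, norm_smul, real_inner_smul_left, real_inner_smul_right,
        Real.norm_eq_abs, Real.norm_eq_abs, mul_pow, mul_pow, sq_abs, sq_abs]
      ring
    exact (sq_eq_sq₀ (norm_nonneg _) (norm_nonneg _)).1 (by rw [hsq, hgram])
  -- zeros of `Φ` at the model lattice norms
  have hzΦ : ∀ n j : ℤ, (n, j) ≠ (0, 0) → Φ (‖(n : ℝ) • m₁ + (j : ℝ) • m₂‖ : ℂ) = 0 := by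
    intro n j hnj
    rw [← hnormeq, hΦF ‖(n : ℝ) • k₁ + (j : ℝ) • k₂‖, hrad _ ((n : ℝ) • k₁ + (j : ℝ) • k₂) (hnorm (norm_nonneg _))]
    exact hz n j hnj
  have hΦ0 := entire_eq_zero_of_vanish_on_latticeNorms Φ hΦd hB hli3 hzΦ
  -- `𝓕A ≡ 0`, inversion
  have hFA : 𝓕 Ad = 0 := by
    funext ξ
    rw [hrad ξ (‖ξ‖ • EuclideanSpace.single i₀ (1 : ℝ)) (by rw [hnorm (norm_nonneg _)]), Pi.zero_apply,
      ← hΦF, hΦ0]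
  have hinv := hAc.fourierInv_fourier_eq hAi (by rw [hFA]; exact integrable_zero _ _ _)
  rw [hFA] at hinv
  intro r hr
  have hv := congrFun hinv (r • EuclideanSpace.single i₀ (1 : ℝ))
  rw [Real.fourierInv_eq'] at hv
  simp only [Pi.zero_apply, smul_zero, integral_zero] at hv
  have : Ad (r • EuclideanSpace.single i₀ (1 : ℝ)) = 0 := hv.symm
  simp only [hAd, hnorm hr] at this
  exact_mod_cast this

/-- **Registered assembly stub `stub_dimAssembly`**: the invisibility theorem in every dimension, as a closed
proposition (= `radial_eq_zero_of_fourier_vanish_dim`). [folklore] -/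
theorem stub_dimAssembly : ∀ (d : ℕ) (k₁ k₂ : EuclideanSpace ℝ (Fin d)), LinearIndependent ℝ ![k₁, k₂] →
    ∀ (α : ℝ → ℝ) (L : ℝ), Continuous α → (∀ r : ℝ, L ≤ r → α r = 0) →
    (∀ n j : ℤ, (n, j) ≠ (0, 0) →
      𝓕 (fun v : EuclideanSpace ℝ (Fin d) => (α ‖v‖ : ℂ)) ((n : ℝ) • k₁ + (j : ℝ) • k₂) = 0) →
    ∀ r : ℝ, 0 ≤ r → α r = 0 :=
  fun _ _ _ hli α L hα hL hz => radial_eq_zero_of_fourier_vanish_dim hli α L hα hL hz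

end Summit.AtomisticToContinuum.Crystallization.Theorems.ThreeConeCertificateExactCertificate.Invisibility

end
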